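import Summits.Ventures.Crystal3D.Theorems.StickyWulffConstantGenericWallFloorBarlowStarRigidity
import Summits.Ventures.Crystal3D.Theorems.StickyWulffConstantGenericWallFloorBarlowEndsPay
import Summits.Ventures.Crystal3D.Theorems.StickyWulffConstantGenericWallFloorStackWalkFrames
import HarnessLib

/-!
# Core avoidance (option (C), part (a′)): a certified walker deep in a Barlow plate carries the plate's bilayer lattice or its
# basal twin — so a family whose frames are apart from the far plate never ENDS deep in it, with NO reach set
# (crux `GenericWallFloor`, stmt-Ventures-19480, line `WallLedgerG`; cf-p1 DECISION (xxxvii⁵): OffR := `FramesApart`)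

HONEST FRAMING. Venture `Summits/Ventures/Crystal3D` (cell `crystal3d-full`), helper `--supports` the crux `GenericWallFloor`
(stmt-Ventures-19480) of `route-Ventures-StickyWulffConstant`, registered line `WallLedgerG`, open stub `stub_twoSlabAdhesion`.
Structure only (census-free); F-C1 not moved; NOT the stub.

WHY.  The positional F4 chain (`walkEnd_not_high_barlow`, …, `barlow_rowhlines`) keeps a family's walkers off the far plate by a REACH
SET hypothesis (`BarlowPairOffReach`, translation-dependent).  Lane T's stub of record is keyed by the translation-FREE `FramesApart`
(`…TexShadowCornerFramesDefs`), clause (i): no frame of family 1 carries `L₂·Λ₀` or `(twinFrame L₂ (L₂ e₃))·Λ₀`.  With the star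
rigidity of `…BarlowStarRigidity` this file is the Barlow analogue of `…SealedStates`:
* **`barlow_frame_of_exact_neighbours_high`** / **`_low`** — sealed frame identification in a clamped plate window
  (`stacking_sealing_above/_below`): a ball of `X` off the rim (`x² + y² ≤ (ρ − 2)²`) at height `≥ h + R₀ + 2` (`≤ −R₀ − 2`) with three
  independent exact `F`-slots in `X` has `F·Λ₀ ∈ {L₂·Λ₀, L₂′·Λ₀}` (`{L₁·Λ₀, L₁′·Λ₀}`).
* **`frame_image_barlow_of_walkInv_high`** / **`_low`** — hence every state satisfying `WalkInv` (any steering) deep in a plate has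
  such a TOP FRAME (`walkCertified_three_independent`).
* **`walkEnd_not_high_apart`** / **`walkEnd_mem_PAY_apart`** (`e₃`-steered, bottom families) and **`walkEnd_not_low_apart`**
  (`−e₃`-steered, top families) — DROP-IN replacements of `walkEnd_not_high_barlow` / `walkEnd_mem_PAY_barlow` /
  `walkEnd_not_low_barlow` with the reach hypotheses (`hoff`, `hreach`) replaced by
  `hapart : ∀ F ∈ M, F·Λ₀ ≠ L₂·Λ₀ ∧ F·Λ₀ ≠ L₂′·Λ₀` (= `FramesApart` (i)/(ii) for `M = cornerFrames`); the price is one unit of rim: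
  start radius `≤ ρ − 2 − (8/3)(h + 4R₀)`, end lateral size `≤ (ρ − 2)²`, end height `< h + R₀ + 2` (`> −R₀ − 2`) — still inside lane
  T's payer window `[−R₀ − 2, h + R₀ + 2]`.
WHAT THIS IS NOT: not the two-family count ((b′) `walkerFamilies_card_le_payers_sep`) and not the re-assembled family specs;
F-C1 not moved.
-/

noncomputable section

namespace Summit.Ventures.Crystal3D.Theorems

open Finset
open Literature.MathematicalPhysics.StatisticalMechanics (barlowPos barlowStacking fccStacking constHagg basalMirror IsHaggSeq
  mem_barlowStacking_iff basalMirror_apply_coord dist_barlowPos_eq_iff)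
open Summit.Ventures.Crystal3D.Cruxes.TextureLiminf.TexShadow (stacking)
open scoped InnerProductSpace

variable {X : Finset (EuclideanSpace ℝ (Fin 3))}

/-! ### Sealed version: frames of balls deep in a clamped plate window -/

/-- **High and off the rim, the frame is the top plate's bilayer frame or its twin** (sealed; Barlow analogue of
`movedFcc_eq_of_exact_neighbours_high`). -/
theorem barlow_frame_of_exact_neighbours_high {σ₂ : ℤ → ℤ} (hσ₂ : IsHaggSeq σ₂)
    (L₂ : EuclideanSpace ℝ (Fin 3) ≃ₗᵢ[ℝ] EuclideanSpace ℝ (Fin 3)) (s₂ : EuclideanSpace ℝ (Fin 3))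
    (X P₂ : Finset (EuclideanSpace ℝ (Fin 3))) (R₀ h ρ : ℝ) (hρ2 : 2 ≤ ρ)
    (hX : ∀ p ∈ X, ∀ q ∈ X, p ≠ q → 1 ≤ dist p q) (hP₂X : P₂ ⊆ X)
    (hcell : ∀ p ∈ X, p 2 ≤ h + 2 * R₀)
    (hP₂ : ∀ p, p ∈ P₂ ↔ (p ∈ stacking L₂ s₂ σ₂ ∧ h + R₀ ≤ p 2 ∧ p 2 ≤ h + 2 * R₀ ∧ p 0 ^ 2 + p 1 ^ 2 ≤ ρ ^ 2))
    (F : EuclideanSpace ℝ (Fin 3) ≃ₗᵢ[ℝ] EuclideanSpace ℝ (Fin 3)) {y : EuclideanSpace ℝ (Fin 3)} (hy : y ∈ X)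
    (hy2 : h + R₀ + 2 ≤ y 2) (hyr : y 0 ^ 2 + y 1 ^ 2 ≤ (ρ - 2) ^ 2)
    {a b c : EuclideanSpace ℝ (Fin 3)} (ha : a ∈ fccSlots) (hb : b ∈ fccSlots) (hc : c ∈ fccSlots)
    (hind : LinearIndependent ℝ ![a, b, c])
    (haX : y + F a ∈ X) (hbX : y + F b ∈ X) (hcX : y + F c ∈ X) :
    F '' fccStacking 1 (Real.sqrt (2 / 3)) = L₂ '' fccStacking 1 (Real.sqrt (2 / 3)) ∨
      F '' fccStacking 1 (Real.sqrt (2 / 3)) =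
        (twinFrame L₂ (L₂ (EuclideanSpace.single (2 : Fin 3) (1 : ℝ)))) '' fccStacking 1 (Real.sqrt (2 / 3)) := by
  have hρ2' : (0 : ℝ) ≤ ρ - 2 := by linarith
  -- slab sealing: high balls off the rim are plate balls
  have hseal : ∀ q ∈ X, h + R₀ + 1 ≤ q 2 → q 0 ^ 2 + q 1 ^ 2 ≤ (ρ - 1) ^ 2 → q ∈ stacking L₂ s₂ σ₂ := by
    intro q hq hq2 hqr
    by_cases hqP : q ∈ P₂
    · exact ((hP₂ q).1 hqP).1
    · exact (stacking_sealing_above hσ₂ L₂ s₂ (h + R₀) (h + 2 * R₀) ρ (by linarith) X P₂ hX hP₂X hP₂ q hq hqP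
        (by linarith) (hcell q hq) hqr).elim
  have hyS : y ∈ stacking L₂ s₂ σ₂ := hseal y hy (by linarith) (hyr.trans (by nlinarith))
  have nbS : ∀ {w : EuclideanSpace ℝ (Fin 3)}, w ∈ fccSlots → y + F w ∈ X → y + F w ∈ stacking L₂ s₂ σ₂ := by
    intro w hw hwX
    have hn1 : ‖F w‖ = 1 := by rw [LinearIsometryEquiv.norm_map, norm_eq_one_of_mem_fccSlots hw]
    apply hseal _ hwX
    · have h1 := abs_apply_sub_le_dist (y + F w) y 2
      rw [dist_eq_norm, add_sub_cancel_left, hn1] at h1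
      have := (abs_le.1 h1).1
      linarith
    · have := lateral_sq_add_le y (F w) hρ2' hyr
      rw [hn1] at this
      convert this using 2; ring
  exact barlow_frame_eq_or_eq_twin hσ₂ L₂ s₂ F hyS ha hb hc hind (nbS ha haX) (nbS hb hbX) (nbS hc hcX)

/-- **Low and off the rim, the frame is the bottom plate's bilayer frame or its twin** (sealed). -/
theorem barlow_frame_of_exact_neighbours_low {σ₁ : ℤ → ℤ} (hσ₁ : IsHaggSeq σ₁)
    (L₁ : EuclideanSpace ℝ (Fin 3) ≃ₗᵢ[ℝ] EuclideanSpace ℝ (Fin 3)) (s₁ : EuclideanSpace ℝ (Fin 3))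
    (X P₁ : Finset (EuclideanSpace ℝ (Fin 3))) (R₀ ρ : ℝ) (hρ2 : 2 ≤ ρ)
    (hX : ∀ p ∈ X, ∀ q ∈ X, p ≠ q → 1 ≤ dist p q) (hP₁X : P₁ ⊆ X)
    (hcell : ∀ p ∈ X, -(2 * R₀) ≤ p 2)
    (hP₁ : ∀ p, p ∈ P₁ ↔ (p ∈ stacking L₁ s₁ σ₁ ∧ -(2 * R₀) ≤ p 2 ∧ p 2 ≤ -R₀ ∧ p 0 ^ 2 + p 1 ^ 2 ≤ ρ ^ 2))
    (F : EuclideanSpace ℝ (Fin 3) ≃ₗᵢ[ℝ] EuclideanSpace ℝ (Fin 3)) {y : EuclideanSpace ℝ (Fin 3)} (hy : y ∈ X)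
    (hy2 : y 2 ≤ -R₀ - 2) (hyr : y 0 ^ 2 + y 1 ^ 2 ≤ (ρ - 2) ^ 2)
    {a b c : EuclideanSpace ℝ (Fin 3)} (ha : a ∈ fccSlots) (hb : b ∈ fccSlots) (hc : c ∈ fccSlots)
    (hind : LinearIndependent ℝ ![a, b, c])
    (haX : y + F a ∈ X) (hbX : y + F b ∈ X) (hcX : y + F c ∈ X) :
    F '' fccStacking 1 (Real.sqrt (2 / 3)) = L₁ '' fccStacking 1 (Real.sqrt (2 / 3)) ∨
      F '' fccStacking 1 (Real.sqrt (2 / 3)) =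
        (twinFrame L₁ (L₁ (EuclideanSpace.single (2 : Fin 3) (1 : ℝ)))) '' fccStacking 1 (Real.sqrt (2 / 3)) := by
  have hρ2' : (0 : ℝ) ≤ ρ - 2 := by linarith
  have hseal : ∀ q ∈ X, q 2 ≤ -R₀ - 1 → q 0 ^ 2 + q 1 ^ 2 ≤ (ρ - 1) ^ 2 → q ∈ stacking L₁ s₁ σ₁ := by
    intro q hq hq2 hqr
    by_cases hqP : q ∈ P₁
    · exact ((hP₁ q).1 hqP).1
    · exact (stacking_sealing_below hσ₁ L₁ s₁ (-(2 * R₀)) (-R₀) ρ (by linarith) X P₁ hX hP₁X hP₁ q hq hqP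
        (hcell q hq) (by linarith) hqr).elim
  have hyS : y ∈ stacking L₁ s₁ σ₁ := hseal y hy (by linarith) (hyr.trans (by nlinarith))
  have nbS : ∀ {w : EuclideanSpace ℝ (Fin 3)}, w ∈ fccSlots → y + F w ∈ X → y + F w ∈ stacking L₁ s₁ σ₁ := by
    intro w hw hwX
    have hn1 : ‖F w‖ = 1 := by rw [LinearIsometryEquiv.norm_map, norm_eq_one_of_mem_fccSlots hw]
    apply hseal _ hwX
    · have h1 := abs_apply_sub_le_dist (y + F w) y 2
      rw [dist_eq_norm, add_sub_cancel_left, hn1] at h1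
      have := (abs_le.1 h1).2
      linarith
    · have := lateral_sq_add_le y (F w) hρ2' hyr
      rw [hn1] at this
      convert this using 2; ring
  exact barlow_frame_eq_or_eq_twin hσ₁ L₁ s₁ F hyS ha hb hc hind (nbS ha haX) (nbS hb hbX) (nbS hc hcX)

/-! ### Walker states deep in a plate -/

/-- **High states carry the top plate's bilayer lattice or its twin.**  `WalkInv X z s` (any steering `z`), the ball `s.1` off the rim
at height `≥ h + R₀ + 2` in the cell of the clamped top plate `P₂`: the top entry `e` has `e.frame·Λ₀ ∈ {L₂·Λ₀, L₂′·Λ₀}`. -/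
theorem frame_image_barlow_of_walkInv_high (hX : ∀ p ∈ X, ∀ q ∈ X, p ≠ q → 1 ≤ dist p q)
    {σ₂ : ℤ → ℤ} (hσ₂ : IsHaggSeq σ₂) (L₂ : EuclideanSpace ℝ (Fin 3) ≃ₗᵢ[ℝ] EuclideanSpace ℝ (Fin 3)) (s₂ : EuclideanSpace ℝ (Fin 3))
    (P₂ : Finset (EuclideanSpace ℝ (Fin 3))) (R₀ h ρ : ℝ) (hρ2 : 2 ≤ ρ) (hP₂X : P₂ ⊆ X)
    (hcell : ∀ p ∈ X, p 2 ≤ h + 2 * R₀)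
    (hP₂ : ∀ p, p ∈ P₂ ↔ (p ∈ stacking L₂ s₂ σ₂ ∧ h + R₀ ≤ p 2 ∧ p 2 ≤ h + 2 * R₀ ∧ p 0 ^ 2 + p 1 ^ 2 ≤ ρ ^ 2))
    {z : EuclideanSpace ℝ (Fin 3)} {s : EuclideanSpace ℝ (Fin 3) × List WalkEntry} (hInv : WalkInv X z s)
    {e : WalkEntry} {rest : List WalkEntry} (hstk : s.2 = e :: rest)
    (hy2 : h + R₀ + 2 ≤ s.1 2) (hyr : s.1 0 ^ 2 + s.1 1 ^ 2 ≤ (ρ - 2) ^ 2) :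
    e.frame '' fccStacking 1 (Real.sqrt (2 / 3)) = L₂ '' fccStacking 1 (Real.sqrt (2 / 3)) ∨
      e.frame '' fccStacking 1 (Real.sqrt (2 / 3)) =
        (twinFrame L₂ (L₂ (EuclideanSpace.single (2 : Fin 3) (1 : ℝ)))) '' fccStacking 1 (Real.sqrt (2 / 3)) := by
  obtain ⟨hyX, hS, e', rest', hstk', hC⟩ := hInv
  rw [hstk] at hstk' hS
  obtain ⟨rfl, rfl⟩ : e = e' ∧ rest = rest' := by
    injection hstk' with h1 h2; exact ⟨h1, h2⟩
  obtain ⟨a, ha, b, hb, c, hc, hind, haX, hbX, hcX⟩ := walkCertified_three_independent (hS.top).1 hC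
  exact barlow_frame_of_exact_neighbours_high hσ₂ L₂ s₂ X P₂ R₀ h ρ hρ2 hX hP₂X hcell hP₂ e.frame hyX hy2 hyr ha hb hc hind
    haX hbX hcX

/-- **Low states carry the bottom plate's bilayer lattice or its twin.** -/
theorem frame_image_barlow_of_walkInv_low (hX : ∀ p ∈ X, ∀ q ∈ X, p ≠ q → 1 ≤ dist p q)
    {σ₁ : ℤ → ℤ} (hσ₁ : IsHaggSeq σ₁) (L₁ : EuclideanSpace ℝ (Fin 3) ≃ₗᵢ[ℝ] EuclideanSpace ℝ (Fin 3)) (s₁ : EuclideanSpace ℝ (Fin 3))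
    (P₁ : Finset (EuclideanSpace ℝ (Fin 3))) (R₀ ρ : ℝ) (hρ2 : 2 ≤ ρ) (hP₁X : P₁ ⊆ X)
    (hcell : ∀ p ∈ X, -(2 * R₀) ≤ p 2)
    (hP₁ : ∀ p, p ∈ P₁ ↔ (p ∈ stacking L₁ s₁ σ₁ ∧ -(2 * R₀) ≤ p 2 ∧ p 2 ≤ -R₀ ∧ p 0 ^ 2 + p 1 ^ 2 ≤ ρ ^ 2))
    {z : EuclideanSpace ℝ (Fin 3)} {s : EuclideanSpace ℝ (Fin 3) × List WalkEntry} (hInv : WalkInv X z s)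
    {e : WalkEntry} {rest : List WalkEntry} (hstk : s.2 = e :: rest)
    (hy2 : s.1 2 ≤ -R₀ - 2) (hyr : s.1 0 ^ 2 + s.1 1 ^ 2 ≤ (ρ - 2) ^ 2) :
    e.frame '' fccStacking 1 (Real.sqrt (2 / 3)) = L₁ '' fccStacking 1 (Real.sqrt (2 / 3)) ∨
      e.frame '' fccStacking 1 (Real.sqrt (2 / 3)) =
        (twinFrame L₁ (L₁ (EuclideanSpace.single (2 : Fin 3) (1 : ℝ)))) '' fccStacking 1 (Real.sqrt (2 / 3)) := by
  obtain ⟨hyX, hS, e', rest', hstk', hC⟩ := hInv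
  rw [hstk] at hstk' hS
  obtain ⟨rfl, rfl⟩ : e = e' ∧ rest = rest' := by
    injection hstk' with h1 h2; exact ⟨h1, h2⟩
  obtain ⟨a, ha, b, hb, c, hc, hind, haX, hbX, hcX⟩ := walkCertified_three_independent (hS.top).1 hC
  exact barlow_frame_of_exact_neighbours_low hσ₁ L₁ s₁ X P₁ R₀ ρ hρ2 hX hP₁X hcell hP₁ e.frame hyX hy2 hyr ha hb hc hind
    haX hbX hcX

/-! ### Ends of apart families: not high / not low, in the payer window -/

/-- **The end of a bottom-family walker whose frames are apart from the top plate is not high** (and is laterally inside) — the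
`FramesApart` replacement of `walkEnd_not_high_barlow`: NO reach set; instead every frame of a sound stack over the bottom entry `b`
lies in `M₁` (`hM₁`) and no frame of `M₁` carries `L₂·Λ₀` or its basal twin (`hapart`).  Start at lateral radius
`≤ ρ − 2 − (8/3)(h + 4R₀)`; then the end is in `X`, has `≤ 11` contacts, lateral size `≤ (ρ − 2)²` and height `< h + R₀ + 2`. -/
theorem walkEnd_not_high_apart (hX : ∀ p ∈ X, ∀ q ∈ X, p ≠ q → 1 ≤ dist p q)
    {s₀ : EuclideanSpace ℝ (Fin 3)} (hs₀ : s₀ ∈ fccSlots) (hcert : ExactOnly 0 (fccSlots.filter fun w => 0 < ⟪w, s₀⟫_ℝ))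
    {σ₂ : ℤ → ℤ} (hσ₂ : IsHaggSeq σ₂) (L₂ : EuclideanSpace ℝ (Fin 3) ≃ₗᵢ[ℝ] EuclideanSpace ℝ (Fin 3))
    (s₂ : EuclideanSpace ℝ (Fin 3)) (R₀ h ρ : ℝ) (hρ : 2 ≤ ρ)
    (P₂ : Finset (EuclideanSpace ℝ (Fin 3))) (hP₂X : P₂ ⊆ X)
    (hcell : ∀ p ∈ X, -(2 * R₀) ≤ p 2 ∧ p 2 ≤ h + 2 * R₀ ∧ p 0 ^ 2 + p 1 ^ 2 ≤ ρ ^ 2)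
    (hP₂ : ∀ p, p ∈ P₂ ↔ (p ∈ stacking L₂ s₂ σ₂ ∧ h + R₀ ≤ p 2 ∧ p 2 ≤ h + 2 * R₀ ∧ p 0 ^ 2 + p 1 ^ 2 ≤ ρ ^ 2))
    (M₁ : Set (EuclideanSpace ℝ (Fin 3) ≃ₗᵢ[ℝ] EuclideanSpace ℝ (Fin 3))) {b : WalkEntry}
    (hM₁ : ∀ stk : List WalkEntry, StackSound (EuclideanSpace.single (2 : Fin 3) (1 : ℝ)) stk →
      StackWF (EuclideanSpace.single (2 : Fin 3) (1 : ℝ)) stk → stk.getLast? = some b → ∀ e ∈ stk, e.frame ∈ M₁)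
    (hapart : ∀ F ∈ M₁, F '' fccStacking 1 (Real.sqrt (2 / 3)) ≠ L₂ '' fccStacking 1 (Real.sqrt (2 / 3)) ∧
      F '' fccStacking 1 (Real.sqrt (2 / 3)) ≠
        (twinFrame L₂ (L₂ (EuclideanSpace.single (2 : Fin 3) (1 : ℝ)))) '' fccStacking 1 (Real.sqrt (2 / 3)))
    {s : EuclideanSpace ℝ (Fin 3) × List WalkEntry}
    (hI : WalkInv X (EuclideanSpace.single (2 : Fin 3) (1 : ℝ)) s)
    (hW : StackWF (EuclideanSpace.single (2 : Fin 3) (1 : ℝ)) s.2) (hlast : s.2.getLast? = some b)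
    (hlat : Real.sqrt (s.1 0 ^ 2 + s.1 1 ^ 2) + 8 / 3 * (h + 4 * R₀) ≤ ρ - 2)
    {N : ℕ} (hN : 8 * (h + 2 * R₀ - ⟪s.1, EuclideanSpace.single (2 : Fin 3) (1 : ℝ)⟫_ℝ) < 3 * N) :
    (walkRun X (EuclideanSpace.single (2 : Fin 3) (1 : ℝ)) N s).1 ∈ X ∧
      (X.filter fun q => dist (walkRun X (EuclideanSpace.single (2 : Fin 3) (1 : ℝ)) N s).1 q = 1).card ≤ 11 ∧
      (walkRun X (EuclideanSpace.single (2 : Fin 3) (1 : ℝ)) N s).1 0 ^ 2 +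
          (walkRun X (EuclideanSpace.single (2 : Fin 3) (1 : ℝ)) N s).1 1 ^ 2 ≤ (ρ - 2) ^ 2 ∧
      (walkRun X (EuclideanSpace.single (2 : Fin 3) (1 : ℝ)) N s).1 2 < h + R₀ + 2 := by
  set e₃ : EuclideanSpace ℝ (Fin 3) := EuclideanSpace.single (2 : Fin 3) (1 : ℝ) with he₃
  have he₃n : ‖e₃‖ = 1 := by rw [he₃, PiLp.norm_single, norm_one]
  have he₃i : ∀ d : EuclideanSpace ℝ (Fin 3), ⟪d, e₃⟫_ℝ = d 2 := fun d => by
    rw [he₃, EuclideanSpace.inner_single_right]; simp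
  have hH : ∀ p ∈ X, ⟪p, e₃⟫_ℝ ≤ h + 2 * R₀ := fun p hp => by rw [he₃i]; exact (hcell p hp).2.1
  obtain ⟨hyX, hydeg, hrise, hcone, -, -⟩ := stackWalk_end hX hs₀ hcert he₃n hH hI hN
  set y := (walkRun X e₃ N s).1 with hy
  -- the drift bound
  have hs1X : s.1 ∈ X := hI.1
  have hrise' : ⟪y - s.1, e₃⟫_ℝ ≤ h + 4 * R₀ := by
    rw [inner_sub_left, he₃i, he₃i]
    have h1 := (hcell y hyX).2.1; have h2 := (hcell s.1 hs1X).1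
    linarith
  have hdrift : ‖y - s.1‖ ≤ 8 / 3 * (h + 4 * R₀) := hcone.trans (by nlinarith)
  -- lateral radius of the end
  have hlat_y : Real.sqrt (y 0 ^ 2 + y 1 ^ 2) ≤ ρ - 2 := by
    have h1 := sqrt_lateral_add_le s.1 (y - s.1)
    rw [add_sub_cancel] at h1
    linarith
  have hlat_y2 : y 0 ^ 2 + y 1 ^ 2 ≤ (ρ - 2) ^ 2 := by
    have h0 : 0 ≤ y 0 ^ 2 + y 1 ^ 2 := by positivity
    have h7 := pow_le_pow_left₀ (Real.sqrt_nonneg (y 0 ^ 2 + y 1 ^ 2)) hlat_y 2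
    rwa [Real.sq_sqrt h0] at h7
  -- the end state and its top frame
  obtain ⟨hIN, hWN⟩ := walkRun_valid hX hs₀ hcert he₃n N hI hW
  obtain ⟨e, rest, hstk, -⟩ := hIN.2.2
  have hlastN : (walkRun X e₃ N s).2.getLast? = some b := by rw [walkRun_getLast? hX hs₀ hcert he₃n N _ hI, hlast]
  have heM : e.frame ∈ M₁ := hM₁ _ hIN.2.1 hWN hlastN e (by rw [hstk]; exact List.mem_cons_self)
  refine ⟨hyX, hydeg, hlat_y2, ?_⟩
  by_contra hhigh
  push Not at hhigh
  rcases frame_image_barlow_of_walkInv_high hX hσ₂ L₂ s₂ P₂ R₀ h ρ hρ hP₂X (fun p hp => (hcell p hp).2.1) hP₂ hIN hstk hhigh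
    hlat_y2 with h1 | h1
  · exact (hapart _ heM).1 h1
  · exact (hapart _ heM).2 h1

/-- **Ends of apart bottom-family walkers lie in the payer window** (`walkEnd_mem_PAY_barlow` without reach sets): given `hlow`
(from `windowStart_end_height_gt`), the end is a ball of `X` with `≠ 12` contacts at height in `[−R₀ − 2, h + R₀ + 2]`. -/
theorem walkEnd_mem_PAY_apart (hX : ∀ p ∈ X, ∀ q ∈ X, p ≠ q → 1 ≤ dist p q)
    {s₀ : EuclideanSpace ℝ (Fin 3)} (hs₀ : s₀ ∈ fccSlots) (hcert : ExactOnly 0 (fccSlots.filter fun w => 0 < ⟪w, s₀⟫_ℝ))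
    {σ₂ : ℤ → ℤ} (hσ₂ : IsHaggSeq σ₂) (L₂ : EuclideanSpace ℝ (Fin 3) ≃ₗᵢ[ℝ] EuclideanSpace ℝ (Fin 3))
    (s₂ : EuclideanSpace ℝ (Fin 3)) (R₀ h ρ : ℝ) (hρ : 2 ≤ ρ)
    (P₂ : Finset (EuclideanSpace ℝ (Fin 3))) (hP₂X : P₂ ⊆ X)
    (hcell : ∀ p ∈ X, -(2 * R₀) ≤ p 2 ∧ p 2 ≤ h + 2 * R₀ ∧ p 0 ^ 2 + p 1 ^ 2 ≤ ρ ^ 2)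
    (hP₂ : ∀ p, p ∈ P₂ ↔ (p ∈ stacking L₂ s₂ σ₂ ∧ h + R₀ ≤ p 2 ∧ p 2 ≤ h + 2 * R₀ ∧ p 0 ^ 2 + p 1 ^ 2 ≤ ρ ^ 2))
    (M₁ : Set (EuclideanSpace ℝ (Fin 3) ≃ₗᵢ[ℝ] EuclideanSpace ℝ (Fin 3))) {b : WalkEntry}
    (hM₁ : ∀ stk : List WalkEntry, StackSound (EuclideanSpace.single (2 : Fin 3) (1 : ℝ)) stk →
      StackWF (EuclideanSpace.single (2 : Fin 3) (1 : ℝ)) stk → stk.getLast? = some b → ∀ e ∈ stk, e.frame ∈ M₁)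
    (hapart : ∀ F ∈ M₁, F '' fccStacking 1 (Real.sqrt (2 / 3)) ≠ L₂ '' fccStacking 1 (Real.sqrt (2 / 3)) ∧
      F '' fccStacking 1 (Real.sqrt (2 / 3)) ≠
        (twinFrame L₂ (L₂ (EuclideanSpace.single (2 : Fin 3) (1 : ℝ)))) '' fccStacking 1 (Real.sqrt (2 / 3)))
    {s : EuclideanSpace ℝ (Fin 3) × List WalkEntry}
    (hI : WalkInv X (EuclideanSpace.single (2 : Fin 3) (1 : ℝ)) s)
    (hW : StackWF (EuclideanSpace.single (2 : Fin 3) (1 : ℝ)) s.2) (hlast : s.2.getLast? = some b)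
    (hlat : Real.sqrt (s.1 0 ^ 2 + s.1 1 ^ 2) + 8 / 3 * (h + 4 * R₀) ≤ ρ - 2)
    {N : ℕ} (hN : 8 * (h + 2 * R₀ - ⟪s.1, EuclideanSpace.single (2 : Fin 3) (1 : ℝ)⟫_ℝ) < 3 * N)
    (hlow : -R₀ - 2 ≤ (walkRun X (EuclideanSpace.single (2 : Fin 3) (1 : ℝ)) N s).1 2) :
    (walkRun X (EuclideanSpace.single (2 : Fin 3) (1 : ℝ)) N s).1 ∈
      X.filter fun y => (X.filter fun q => dist y q = 1).card ≠ 12 ∧ -R₀ - 2 ≤ y 2 ∧ y 2 ≤ h + R₀ + 2 := by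
  obtain ⟨hyX, hydeg, -, hhigh⟩ := walkEnd_not_high_apart hX hs₀ hcert hσ₂ L₂ s₂ R₀ h ρ hρ P₂ hP₂X hcell hP₂ M₁ hM₁ hapart
    hI hW hlast hlat hN
  rw [Finset.mem_filter]
  exact ⟨hyX, by omega, hlow, by linarith⟩

/-- **The end of a top-family walker whose frames are apart from the bottom plate is not low** (vertical `−e₃`; the `FramesApart`
replacement of `walkEnd_not_low_barlow`): end in `X`, `≤ 11` contacts, lateral size `≤ (ρ − 2)²`, height `> −R₀ − 2`. -/
theorem walkEnd_not_low_apart (hX : ∀ p ∈ X, ∀ q ∈ X, p ≠ q → 1 ≤ dist p q)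
    {sE : EuclideanSpace ℝ (Fin 3)} (hsE : sE ∈ fccSlots) (hcert : ExactOnly 0 (fccSlots.filter fun w => 0 < ⟪w, sE⟫_ℝ))
    {σ₁ : ℤ → ℤ} (hσ₁ : IsHaggSeq σ₁) (L₁ : EuclideanSpace ℝ (Fin 3) ≃ₗᵢ[ℝ] EuclideanSpace ℝ (Fin 3))
    (s₀ : EuclideanSpace ℝ (Fin 3)) (R₀ h ρ : ℝ) (hρ : 2 ≤ ρ)
    (P₁ : Finset (EuclideanSpace ℝ (Fin 3))) (hP₁X : P₁ ⊆ X)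
    (hcell : ∀ p ∈ X, -(2 * R₀) ≤ p 2 ∧ p 2 ≤ h + 2 * R₀ ∧ p 0 ^ 2 + p 1 ^ 2 ≤ ρ ^ 2)
    (hP₁ : ∀ p, p ∈ P₁ ↔ (p ∈ stacking L₁ s₀ σ₁ ∧ -(2 * R₀) ≤ p 2 ∧ p 2 ≤ -R₀ ∧ p 0 ^ 2 + p 1 ^ 2 ≤ ρ ^ 2))
    (M₂ : Set (EuclideanSpace ℝ (Fin 3) ≃ₗᵢ[ℝ] EuclideanSpace ℝ (Fin 3))) {b : WalkEntry}
    (hM₂ : ∀ stk : List WalkEntry, StackSound (-EuclideanSpace.single (2 : Fin 3) (1 : ℝ)) stk →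
      StackWF (-EuclideanSpace.single (2 : Fin 3) (1 : ℝ)) stk → stk.getLast? = some b → ∀ e ∈ stk, e.frame ∈ M₂)
    (hapart : ∀ F ∈ M₂, F '' fccStacking 1 (Real.sqrt (2 / 3)) ≠ L₁ '' fccStacking 1 (Real.sqrt (2 / 3)) ∧
      F '' fccStacking 1 (Real.sqrt (2 / 3)) ≠
        (twinFrame L₁ (L₁ (EuclideanSpace.single (2 : Fin 3) (1 : ℝ)))) '' fccStacking 1 (Real.sqrt (2 / 3)))
    {s : EuclideanSpace ℝ (Fin 3) × List WalkEntry}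
    (hI : WalkInv X (-EuclideanSpace.single (2 : Fin 3) (1 : ℝ)) s)
    (hW : StackWF (-EuclideanSpace.single (2 : Fin 3) (1 : ℝ)) s.2) (hlast : s.2.getLast? = some b)
    (hlat : Real.sqrt (s.1 0 ^ 2 + s.1 1 ^ 2) + 8 / 3 * (h + 4 * R₀) ≤ ρ - 2)
    {N : ℕ} (hN : 8 * (2 * R₀ - ⟪s.1, -EuclideanSpace.single (2 : Fin 3) (1 : ℝ)⟫_ℝ) < 3 * N) :
    (walkRun X (-EuclideanSpace.single (2 : Fin 3) (1 : ℝ)) N s).1 ∈ X ∧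
      (X.filter fun q => dist (walkRun X (-EuclideanSpace.single (2 : Fin 3) (1 : ℝ)) N s).1 q = 1).card ≤ 11 ∧
      (walkRun X (-EuclideanSpace.single (2 : Fin 3) (1 : ℝ)) N s).1 0 ^ 2 +
          (walkRun X (-EuclideanSpace.single (2 : Fin 3) (1 : ℝ)) N s).1 1 ^ 2 ≤ (ρ - 2) ^ 2 ∧
      -R₀ - 2 < (walkRun X (-EuclideanSpace.single (2 : Fin 3) (1 : ℝ)) N s).1 2 := by
  set zt : EuclideanSpace ℝ (Fin 3) := -EuclideanSpace.single (2 : Fin 3) (1 : ℝ) with hzt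
  have hztn : ‖zt‖ = 1 := by rw [hzt, norm_neg, PiLp.norm_single, norm_one]
  have hzti : ∀ d : EuclideanSpace ℝ (Fin 3), ⟪d, zt⟫_ℝ = -d 2 := fun d => by
    rw [hzt, inner_neg_right, EuclideanSpace.inner_single_right]; simp
  have hH : ∀ p ∈ X, ⟪p, zt⟫_ℝ ≤ 2 * R₀ := fun p hp => by rw [hzti]; linarith [(hcell p hp).1]
  obtain ⟨hyX, hydeg, hrise, hcone, -, -⟩ := stackWalk_end hX hsE hcert hztn hH hI hN
  set y := (walkRun X zt N s).1 with hy
  have hs1X : s.1 ∈ X := hI.1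
  have hrise' : ⟪y - s.1, zt⟫_ℝ ≤ h + 4 * R₀ := by
    rw [inner_sub_left, hzti, hzti]
    have h1 := (hcell y hyX).1; have h2 := (hcell s.1 hs1X).2.1
    linarith
  have hdrift : ‖y - s.1‖ ≤ 8 / 3 * (h + 4 * R₀) := hcone.trans (by nlinarith)
  have hlat_y : Real.sqrt (y 0 ^ 2 + y 1 ^ 2) ≤ ρ - 2 := by
    have h1 := sqrt_lateral_add_le s.1 (y - s.1)
    rw [add_sub_cancel] at h1
    linarith
  have hlat_y2 : y 0 ^ 2 + y 1 ^ 2 ≤ (ρ - 2) ^ 2 := by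
    have h0 : 0 ≤ y 0 ^ 2 + y 1 ^ 2 := by positivity
    have h7 := pow_le_pow_left₀ (Real.sqrt_nonneg (y 0 ^ 2 + y 1 ^ 2)) hlat_y 2
    rwa [Real.sq_sqrt h0] at h7
  obtain ⟨hIN, hWN⟩ := walkRun_valid hX hsE hcert hztn N hI hW
  obtain ⟨e, rest, hstk, -⟩ := hIN.2.2
  have hlastN : (walkRun X zt N s).2.getLast? = some b := by rw [walkRun_getLast? hX hsE hcert hztn N _ hI, hlast]
  have heM : e.frame ∈ M₂ := hM₂ _ hIN.2.1 hWN hlastN e (by rw [hstk]; exact List.mem_cons_self)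
  refine ⟨hyX, hydeg, hlat_y2, ?_⟩
  by_contra hlow
  push Not at hlow
  rcases frame_image_barlow_of_walkInv_low hX hσ₁ L₁ s₀ P₁ R₀ ρ hρ hP₁X (fun p hp => (hcell p hp).1) hP₁ hIN hstk hlow
    hlat_y2 with h1 | h1
  · exact (hapart _ heM).1 h1
  · exact (hapart _ heM).2 h1

end Summit.Ventures.Crystal3D.Theorems

end
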